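import Literature.MathematicalPhysics.QuantumFieldTheory.Balaban1983to89.T4HybridMatching
import Literature.MathematicalPhysics.QuantumFieldTheory.Balaban1983to89.T4Crossover

/-!
# `Balaban1983to89.T4WeightBudget` — the WEIGHT BUDGET of the uniqueness spine: the output shape of the cell's
estimate NE7b, its plug into the hybrid matching / crossover sums, and the renewal arithmetic behind it
(cell `pub-balaban`, T4-DAG v2 §5 row T4-U5c.E, node U5c; kernel bookkeeping, Mathlib + `T4HybridMatching` + `T4Crossover`)

HONEST FRAMING (cell `pub-balaban`, T4-DAG PAGE 1).  The cell's T4 target is the existence AND uniqueness of the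
continuum limit of Bałaban's unit-scale averaged loop expectations on a finite torus — a constructive-QFT statement
strictly beyond ultraviolet stability ([Balaban1989LargeFieldII] Thm 1 p. 355); it is NOT the Yang–Mills mass gap and
NOT the Clay problem.  This module is the KERNEL part of ONE row (T4-U5c.E) of the uniqueness spine: (§1) the cell's NEW
estimate NE7b TYPED IN THE OUTPUT SHAPE the already-landed bookkeeping consumes (`T4HybridMatching.cauchy_of_hybrid`,
`T4Crossover.cauchySum_of_crossover`) and the three plugs; (§2) the union bound by which such a weight bound is assembled
from local ones; (§3) the elementary RENEWAL ARITHMETIC (a covering count, a product bound, two geometric sums, a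
summability-over-`K` lemma and the sign condition of the net survival rate) that the cell's paper-level sketch of NE7b
(`t4/T4-EST-U5c.md`) reduces to.  Everything here is [folklore] real analysis / finite combinatorics; NOTHING of
Bałaban's is asserted: the one named hypothesis shape `RelWeightBound` is consumed only as `(hW : RelWeightBound …)`.
Value = typed estimate shape + kernel bookkeeping; NOT summit progress, NOT a proof of NE7b or NE7.
v1.1 (DOCSTRING-ONLY; every declaration unchanged): (a) the King (3.10) gloss corrected — `p(·)` is King's large-field
FUNCTION (3.1), the positive power of the lattice spacing comes from «exp[−p(ε)²] ≤ ε^σ» p. 657 (GAPS G-pv05g5-1 (a));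
(b) MERGERS ARE EVENTS: the informal readings of §3 (`card_Icc_le_of_windows`, `prod_le_pow_of_card_le`, `survivalRate`)
now count merger steps with renewal steps ([Balaban1989LargeFieldII] p. 386 second case, p. 387 «K ≤ K₂ + n₁ + R_{j+1}»;
GAPS G-pv05g5-1 (b), G-t4-U5c-2); cross-read of v1: XREAD ok-with-remarks (C-pv05g5-2).

CITATION HEADER (lean-in-tree rule 2026-08-18; every «…» below was READ BY THIS SEAT ON THE RENDERED JOURNAL PAGE, PNG ×2,
and is quoted for CONTEXT AND SHAPE ONLY — no statement of the audited manuscripts enters any declaration as a fact).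
* [Balaban1989LargeFieldI] = T. Bałaban, *Large field renormalization. I. The basic step of the ℝ operation*, Commun.
  Math. Phys. **122** (1989) 175–202 (cell paper B15; PDF page = journal page − 174).  p. 177 [render
  `b2b-balaban-ref1/pages/1989-cmp122-large-field-I/1989-cmp122-large-field-I-p003-x2.png`], the class of components the
  ℝ-operation renormalises: «we consider the class of components such that each satisfies the following two properties:
  (i) it is contained in a cube of the size 100MR_k, (ii) in the preceding N renormalization steps no new large field
  regions were created inside this component, and the previous regions contained in it satisfy the condition (i) on the
  corresponding scales.»  (So a component stays PENDING past the window only by violating (i) — in particular after a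
  MERGER with other components or new regions by the layer operations of a step, [Balaban1989LargeFieldII] p. 386 /
  p. 387 quoted below, which restarts the window — or by being RENEWED — new large fields created inside it; renewals
  and mergers together are the EVENTS of §3; this reading is the cell's, T4-DAG v3 §2 U5c / GAPS G-t4-U4-3 (n1),
  G-t4-U5c-2, G-pv05g5-1 (b).)
* [Balaban1989LargeFieldII] = T. Bałaban, *Large field renormalization. II. Localization, exponentiation, and bounds for
  the ℝ operation*, Commun. Math. Phys. **122** (1989) 355–392 (cell paper B16; PDF page = journal page − 354).
  p. 384 [render `…/1989-cmp122-large-field-II/1989-cmp122-large-field-II-p030-x2.png`]: «If Z is a component of Z_j, and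
  j(Z) is the index of a first large field region contained in Z, then we write the factor connected with Z in the form
  exp(−κ_j(Z) − 2p₀(g_{j(Z)})). The basic inductive statement concerns these factors, or the numbers κ_j(Z).» and the
  statement «The factor exp(−κ_j(Z)) controls K renormalization steps, under the assumption that no large fields are
  created in these steps, where the number K is the smallest positive integer having the property that the domain S^K(Z),
  considered as a domain in the lattice of the scale L^{−(j+K)}, satisfies the conditions (i), (ii), with N = R_j. More
  precisely this means that κ_j(Z) ≥ Σ_{n=j+1}^{j+K} O(1)M^dR_n^{d+1}d′_n(S^{n−j}(Z)). (1.80)»; p. 386 [p032]: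
  «In the second case Z is obtained from some number of components of Z_j, and some number of new large field regions,
  joined together into the one component of Z_{j+1} by the operations of the last step, in particular by adding layers
  of MR_{j+1}-cubes.» (a MERGER; the number of new regions may be zero), (1.85) and
  «The index j(Z) is equal to one of the indices j(X), j(Y), hence 2p₀(g_{j(X)}) + 2p₀(g_{j(Y)}) − 2p₀(g_{j(Z)}) ≥
  2(1 + β₀)^{−1}p₀(g_{j+1}).»; p. 387 [p033]: «≤ κ_{j+1}(Z) − 2(1 + β₀)^{−1}p₀(g_{j+1}) + O(1)3(100M)^dR^{d+2}_{j+1} ≤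
  κ_{j+1}(Z), (1.88) for p₀ large and γ small enough.», before it the merged component's window «It is clear that
  applying n₁ times the operation S to the last domain, where n₁ is a rather small number, e.g., n₁ < 10, we obtain the
  domain S^{K₁+n₁}(Y) containing S^{K₁+n₁}(X). This implies that S^{n−j−1}(Z) = S^{n−j−1}(Y) for n ≥ j + 1 + K₁ + n₁,
  and that K ≤ K₂ + n₁ + R_{j+1}.», and the fundamental inequality «T′_k(X)1 ≤ exp(−2(1 +
  β₀)^{−1}p₀(g_k)). (1.89)»; p. 389 [p035]: «We assume that g_k is so small that −2(1 + β₀)^{−1}p₀(g_k) + 1 + 2κ(100R_k)^d ≤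
  −(3/2)p₀(g_k) (for example, take β₀ = 1/7, then this means that −(1/4)p₀(g_k) + 1 + 2κ(100R_k)^d ≤ 0, and before we had
  stronger restrictions on p₀(g_k)).»  These are SIZE bounds on the large-field factors of ONE run at ONE cutoff; the
  surplus discarded in the last step of (1.88) is what the cell's NE7b proposes to bank (see `t4/T4-EST-U5c.md` §3) —
  that banking, the relative-weight extraction and the survival-window bound are NOT PRINTED and are NOT asserted here.
* [King1986] = C. King, *The U(1) Higgs model. I. The continuum limit*, Commun. Math. Phys. **102** (1986) 649–677, p. 656
  [render `b2b-balaban-template/king-renders/1986-cmp102-king-u1-higgs-I-p008-x2.png`] (3.10): «|Z^{ε_K}(T_{ε_K}, g, h) −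
  Z^{ε_{K+n}}(T_{ε_{K+n}}, g, h)| ≤ ∫(dA_k)(dφ_k)χ_k(A_k, φ_k)·|exp[−S^{(k),1} + C(L^kε_K)^σ|T|] − exp[−S^{(k+n),1} +
  C(L^kε_K)^σ|T|]| + exp[−p(L^kε_K)² + C|T|]. (3.10)» — the printed MODEL of "matched part + large-field complement
  bounded by WEIGHT".  In `exp[−p(L^kε_K)² + C|T|]` the symbol `p(·)` is King's LARGE-FIELD FUNCTION, p. 655 [render
  `…-p007-x2.png`]: «p(ε) = b₀(1 + log ε^{−1})^p, (3.1) where p is a small integer and b₀ is a constant O(1).», evaluated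
  at `ε = L^kε_K` and squared (v1 misdescribed it as a coefficient times `(L^kε_K)²` — corrected, GAPS G-pv05g5-1 (a));
  the complement becomes a positive power of the current lattice spacing one step later, p. 657 [render `…-p009-x2.png`]:
  «where we have used the ultra-violet stability bound and exp[−p(ε)²] ≤ ε^σ for ε small, since p ≥ 1.» — the positive
  power of the lattice spacing that the marginal d = 4 theory lacks ([Balaban1989LargeFieldI] p. 175, quoted in
  `T4HybridMatching`).  Tag of `RelWeightBound` only; a hypothesis shape.

WHAT IS PROVED (kernel; all [folklore]; zero `sorry`, no new axiom; imports `T4HybridMatching`, `T4Crossover`).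
§1 `RelWeightBound l₀ T A B Bad W` (NE7b's OUTPUT per T4-DAG v2 §2 U5c / GAPS G-pv12g4-1 (b): a RELATIVE weight bound
   `W K` for the bad class, per run, at fixed `(K, t)`, for BOTH runs, uniform in `|t| ≤ l₀`, `0 ≤ W K < 1`, `Σ W < ∞`);
   `hybridSandwich_of_relWeightBound` (with the good set `T K ∖ Bad K t`); `cauchy_of_relWeightBound` (⇒ matching modulo
   constants with remainders `hybridDelta vol δ W`, summable, Cauchy, uniform convergence — `T4HybridMatching.cauchy_of_hybrid`);
   `crossoverDelta_weightSlot` (the slot identity `crossoverDelta … (K ↦ (−log(1 − W K))/vol) = hybridDelta vol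
   (crossoverDelta … 0) W`) and `cauchySum_of_crossover_relWeightBound` (= `T4Crossover.cauchySum_of_crossover` with its
   weight slot DISCHARGED by a `RelWeightBound`: the analytic end U4′ + U5b + U5c ⇒ U5 ⇒ U6 of the spine assembled, every
   named estimate a hypothesis); `relWeightBound_of_eventually` (early steps: bad classes emptied / weights zeroed below `K₀`).
§2 `sum_biUnion_le_sum`, `relWeight_le_sum_of_cover` (a bad class covered by sub-classes of relative weights `w x` has
   relative weight `≤ Σ w x` — the union bound over birth position / birth scale / event (renewal-and-merger) history).
§3 `card_Icc_le_of_windows` (EVENT COUNT — v1.1: events = birth ∪ renewals ∪ mergers —: if every step of `[j, K]`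
   lies `< N` steps after an element of `S`, then
   `K + 1 − j ≤ N·#S`), `prod_le_pow_of_card_le`, `survivalRate p E N L := (p − E)/N − 4 log L` with
   `survivalRate_pos_iff` (`> 0 ↔ p/N > 4 log L + E/N` — the node's condition "p₀(g)/N > 4 log L·(1 + o(1))") and
   `exp_entropy_mul_exp_survival_lt_one_iff`, `sum_pow_le_of_le` / `sum_range_pow_sub_le` (the age sums
   `Σ_{j<j⋆} r^{K−j} ≤ r^{K−j⋆+1}/(1 − r)`), `twoRate_majorant_le`, `summable_weightMajorant` and
   `eventually_weightMajorant_lt` (`K ↦ V·r^{K − j⋆(K)}` is summable and eventually `< ε` when `c·K ≤ K − j⋆(K)`, `0 < r < 1`).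

Located, NOT touched (cell records `t4/T4-EST-U5c.md`, GAPS G-pv14-7…): the measure-level objects (terms of the
inductive representation (2.18) [III] as a finite family, large-field histories, the two runs' term structure) have no
carrier in the tree — `RelWeightBound` is stated over ABSTRACT finite families exactly like `HybridSandwich`; the
conditions on `N`, `p₀`, `R_k` ([Balaban1989LargeFieldI] p. 198 (1.94); [Balaban1989LargeFieldII] p. 389) enter only
through the abstract parameters `p E N L` of §3.  Unit `b2b-balaban-pv14` gen 3 (journal CLAIM T4-U5c.E 2026-08-18T20:51:07Z).
-/

open Finset _root_.Filter _root_.Topology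

namespace Literature.MathematicalPhysics.QuantumFieldTheory.Balaban1983to89.T4WeightBudget

open T4HybridMatching T4CauchySum T4Crossover

/-! ## §1 The output shape NE7b must deliver, and its plug into nodes U5/U6 -/

/-- NAMED HYPOTHESIS SHAPE `RelWeightBound` (cell estimate NE7b in the OUTPUT SHAPE the kernel consumes, T4-DAG v2 §2
U5c / GAPS G-pv12g4-1 (b); NOT a printed statement, NOT asserted).  For every number of steps `K` and every source
strength `|t| ≤ l₀`: run A's dressed partition function is the finite sum of the NONNEGATIVE term weights `A K t τ`,
`τ ∈ T K`, run B's (after node U5d's partial summation into A's classes) of `B K t τ`; `Bad K t ⊆ T K` is the class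
of terms carrying OLD PENDING large-field structure (older than `K − j⋆(K)`); and the RELATIVE weight of that class is
at most `W K` IN EACH RUN SEPARATELY, with `0 ≤ W K < 1` and `Σ_K W K < ∞`.  The printed MODEL of a weight bound
for an unmatched class is King's large-field complement (3.10)–(3.11) (abelian Higgs₂,₃, where the complement carries
a positive power of the lattice spacing — exactly what d = 4 lacks, [Balaban1989LargeFieldI] p. 175); the d = 4
version is the cell's NEW estimate NE7b and is NOT in print. [cite: King1986, (3.10)–(3.11) p. 656] -/
structure RelWeightBound {ι : Type*} (l₀ : ℝ) (T : ℕ → Finset ι) (A B : ℕ → ℝ → ι → ℝ)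
    (Bad : ℕ → ℝ → Finset ι) (W : ℕ → ℝ) : Prop where
  /-- the bad class consists of terms -/
  bad_subset : ∀ K t, |t| ≤ l₀ → Bad K t ⊆ T K
  /-- the weight bounds are nonnegative -/
  nonneg : ∀ K, 0 ≤ W K
  /-- … strictly below one (so that `−log(1 − W K)` is finite) -/
  lt_one : ∀ K, W K < 1
  /-- … and summable over the number of steps -/
  summable : Summable W
  /-- run A: the bad class has relative weight at most `W K` -/
  bad_left : ∀ K t, |t| ≤ l₀ → ∑ τ ∈ Bad K t, A K t τ ≤ W K * ∑ τ ∈ T K, A K t τ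
  /-- run B: the bad class has relative weight at most `W K` -/
  bad_right : ∀ K t, |t| ≤ l₀ → ∑ τ ∈ Bad K t, B K t τ ≤ W K * ∑ τ ∈ T K, B K t τ

section Plug

variable {ι : Type*} [DecidableEq ι] {l₀ vol : ℝ} {T : ℕ → Finset ι} {A B : ℕ → ℝ → ι → ℝ}
  {Bad : ℕ → ℝ → Finset ι} {W δ : ℕ → ℝ}

/-- **NE7b-output + term-wise matching on the good class ⇒ the hybrid sandwich of node U5.**  If the bad classes have
relative weight `≤ W K` in both runs (`RelWeightBound`), all term weights are nonnegative, and OFF the bad class the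
two runs' terms are sandwiched `e^{c_K ∓ vol·δ K}` with a `t`-independent constant `c_K` (node U5b's recent-scale rates +
node U4′'s old-scale sizes — hypotheses here), then for every `K` the families satisfy
`HybridSandwich (T K) (T K ∖ Bad K t) (A K t) (B K t) c_K (vol·δ K) (W K)` for all `|t| ≤ l₀`. [folklore] -/
theorem hybridSandwich_of_relWeightBound (hW : RelWeightBound l₀ T A B Bad W)
    (hA : ∀ K t, |t| ≤ l₀ → ∀ τ ∈ T K, 0 ≤ A K t τ) (hB : ∀ K t, |t| ≤ l₀ → ∀ τ ∈ T K, 0 ≤ B K t τ)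
    (hgood : ∀ K : ℕ, ∃ c : ℝ, ∀ t : ℝ, |t| ≤ l₀ → ∀ τ ∈ T K \ Bad K t,
      Real.exp (c - vol * δ K) * A K t τ ≤ B K t τ ∧ B K t τ ≤ Real.exp (c + vol * δ K) * A K t τ) :
    ∀ K : ℕ, ∃ c : ℝ, ∀ t : ℝ, |t| ≤ l₀ →
      ∃ G : Finset ι, HybridSandwich (T K) G (A K t) (B K t) c (vol * δ K) (W K) := by
  intro K
  obtain ⟨c, hc⟩ := hgood K
  refine ⟨c, fun t ht => ⟨T K \ Bad K t, ?_⟩⟩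
  have hsd : T K \ (T K \ Bad K t) = Bad K t := Finset.sdiff_sdiff_eq_self (hW.bad_subset K t ht)
  exact
    { subset := Finset.sdiff_subset
      nonneg_left := hA K t ht
      nonneg_right := hB K t ht
      lower := fun τ hτ => (hc t ht τ hτ).1
      upper := fun τ hτ => (hc t ht τ hτ).2
      bad_left := by rw [hsd]; exact hW.bad_left K t ht
      bad_right := by rw [hsd]; exact hW.bad_right K t ht }

/-- **NE7b-output + good-class matching + summable term-wise remainders ⇒ node U6's Cauchy property** (CONDITIONAL
kernel theorem; `T4HybridMatching.cauchy_of_hybrid` with the good set `T K ∖ Bad K t`).  Conclusions: matching modulo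
constants with remainders `hybridDelta vol δ W K = δ K + (−log(1 − W K))/vol`, their summability, the Cauchy property
of every generating-function sequence on `|t| ≤ l₀`, and uniform convergence there.  Nothing is asserted for Bałaban's
objects: `RelWeightBound` (NE7b), the good-class sandwich (NE7's term-wise half) and `Summable δ` (node U4′) are
hypotheses. [folklore] -/
theorem cauchy_of_relWeightBound {Z : ℕ → ℝ → ℝ} (hvol : 0 < vol) (hl₀ : 0 ≤ l₀)
    (hW : RelWeightBound l₀ T A B Bad W)
    (hZA : ∀ K t, |t| ≤ l₀ → Z K t = ∑ τ ∈ T K, A K t τ)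
    (hZB : ∀ K t, |t| ≤ l₀ → Z (K + 1) t = ∑ τ ∈ T K, B K t τ)
    (hA : ∀ K t, |t| ≤ l₀ → ∀ τ ∈ T K, 0 ≤ A K t τ) (hB : ∀ K t, |t| ≤ l₀ → ∀ τ ∈ T K, 0 ≤ B K t τ)
    (hpos : ∀ K t, |t| ≤ l₀ → 0 < ∑ τ ∈ T K, A K t τ) (hδ : Summable δ)
    (hgood : ∀ K : ℕ, ∃ c : ℝ, ∀ t : ℝ, |t| ≤ l₀ → ∀ τ ∈ T K \ Bad K t,
      Real.exp (c - vol * δ K) * A K t τ ≤ B K t τ ∧ B K t τ ≤ Real.exp (c + vol * δ K) * A K t τ) :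
    MatchingModConstants vol l₀ (hybridDelta vol δ W) Z ∧ Summable (hybridDelta vol δ W) ∧
    (∀ t : ℝ, |t| ≤ l₀ → CauchySeq fun K => genFun Z K t) ∧
    TendstoUniformlyOn (fun K t => genFun Z K t) (genFunLim Z) atTop {t | |t| ≤ l₀} :=
  cauchy_of_hybrid hvol hl₀ T A B hZA hZB hW.nonneg hW.lt_one hW.summable hδ hpos
    (hybridSandwich_of_relWeightBound hW hA hB hgood)

/-- THE SLOT IDENTITY (T4-DAG v2 §2 U5c: "the slot `w K := (−log(1 − W_K))/vol` of `T4Crossover.cauchySum_of_crossover`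
then composes verbatim"): the crossover majorant with the weight slot filled by `(−log(1 − W K))/vol` IS the hybrid
remainder sequence of the crossover majorant without slot. [folklore] -/
theorem crossoverDelta_weightSlot (E a θ Λ R₁ C vol : ℝ) (κ₀ : ℕ) (gs : ℕ → ℕ → ℝ) (W : ℕ → ℝ) :
    crossoverDelta E a θ Λ R₁ C κ₀ gs (fun K => -Real.log (1 - W K) / vol) =
      hybridDelta vol (crossoverDelta E a θ Λ R₁ C κ₀ gs 0) W := by
  funext K
  simp only [crossoverDelta, hybridDelta, Pi.zero_apply, add_zero]

/-- **The uniqueness spine's analytic end, assembled** (CONDITIONAL kernel theorem = `T4Crossover.cauchySum_of_crossover`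
with its weight slot DISCHARGED by an NE7b-output): under the hypotheses of `T4Crossover.summable_crossoverDelta` for the
E/R crossover sums (node U4′: `0 < a < 1`, `0 < θ < 1`, `θ ≤ Λ`, the lower (0.31) for the couplings, `κ₀ > 4`), a
`RelWeightBound` with weights `W` (node U5c, NE7b), and the good-class sandwich with term-wise remainder
`vol · crossoverDelta … 0 K` (nodes U5b/U4′, NE7's term-wise half), the dressed partition functions match modulo
constants with the summable remainders `crossoverDelta … (fun K ↦ (−log(1 − W K))/vol)`, every generating-function
sequence is Cauchy on `|t| ≤ l₀`, and the convergence is uniform there — the input of node U0.  Every named estimate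
of the cell (NE7, NE7b, (0.31), L1-pos) enters as a hypothesis; nothing of Bałaban's is asserted. [folklore] -/
theorem cauchySum_of_crossover_relWeightBound {E a θ Λ b β' R₁ C : ℝ} {κ₀ : ℕ} {g : ℕ → ℝ} {gs : ℕ → ℕ → ℝ}
    {Z : ℕ → ℝ → ℝ} (ha0 : 0 < a) (ha1 : a < 1) (hθ : 0 < θ) (hθ1 : θ < 1) (hθΛ : θ ≤ Λ) (hb : 0 < b)
    (h031 : ∀ K, Step.Discrete031 b β' K (g K) (gs K)) (hgs : ∀ K k, k ≤ K → 0 ≤ gs K k) (hR₁ : 0 ≤ R₁)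
    (hC : 0 ≤ C) (hκ : 4 < κ₀) (hvol : 0 < vol) (hl₀ : 0 ≤ l₀)
    (hW : RelWeightBound l₀ T A B Bad W)
    (hZA : ∀ K t, |t| ≤ l₀ → Z K t = ∑ τ ∈ T K, A K t τ)
    (hZB : ∀ K t, |t| ≤ l₀ → Z (K + 1) t = ∑ τ ∈ T K, B K t τ)
    (hA : ∀ K t, |t| ≤ l₀ → ∀ τ ∈ T K, 0 ≤ A K t τ) (hB : ∀ K t, |t| ≤ l₀ → ∀ τ ∈ T K, 0 ≤ B K t τ)
    (hpos : ∀ K t, |t| ≤ l₀ → 0 < ∑ τ ∈ T K, A K t τ)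
    (hgood : ∀ K : ℕ, ∃ c : ℝ, ∀ t : ℝ, |t| ≤ l₀ → ∀ τ ∈ T K \ Bad K t,
      Real.exp (c - vol * crossoverDelta E a θ Λ R₁ C κ₀ gs 0 K) * A K t τ ≤ B K t τ ∧
        B K t τ ≤ Real.exp (c + vol * crossoverDelta E a θ Λ R₁ C κ₀ gs 0 K) * A K t τ) :
    MatchingModConstants vol l₀ (crossoverDelta E a θ Λ R₁ C κ₀ gs (fun K => -Real.log (1 - W K) / vol)) Z ∧
    Summable (crossoverDelta E a θ Λ R₁ C κ₀ gs (fun K => -Real.log (1 - W K) / vol)) ∧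
    (∀ t : ℝ, |t| ≤ l₀ → CauchySeq fun K => genFun Z K t) ∧
    TendstoUniformlyOn (fun K t => genFun Z K t) (genFunLim Z) atTop {t | |t| ≤ l₀} := by
  have hδ0 : Summable (crossoverDelta E a θ Λ R₁ C κ₀ gs 0) :=
    summable_crossoverDelta (E := E) (Λ := Λ) (R₁ := R₁) (C := C) (w := 0)
      ha0 ha1 hθ hθ1 hθΛ hb h031 hgs hR₁ hC hκ summable_zero
  rw [crossoverDelta_weightSlot]
  exact cauchy_of_relWeightBound hvol hl₀ hW hZA hZB hA hB hpos hδ0 hgood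

omit [DecidableEq ι] in
/-- EARLY STEPS (T4-DAG v2 §2 U5c: "early K are covered by the one-class instance … summability is a tail property").
A weight bound that is only available from some `K₀` on — `0 ≤ W K < 1` and the two relative bounds for `K ≥ K₀`,
`Σ W < ∞` — gives a `RelWeightBound` with the bad classes EMPTIED and the weights ZEROED below `K₀` (there the whole
family must then be matched term-wise, e.g. as ONE class with any finite two-sided bound,
`T4HybridMatching.HybridSandwich.of_abs_log_sub_le`). [folklore] -/
theorem relWeightBound_of_eventually {K₀ : ℕ} (hsub : ∀ K t, |t| ≤ l₀ → K₀ ≤ K → Bad K t ⊆ T K)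
    (h0 : ∀ K, K₀ ≤ K → 0 ≤ W K) (h1 : ∀ K, K₀ ≤ K → W K < 1) (hs : Summable W)
    (hl : ∀ K t, |t| ≤ l₀ → K₀ ≤ K → ∑ τ ∈ Bad K t, A K t τ ≤ W K * ∑ τ ∈ T K, A K t τ)
    (hr : ∀ K t, |t| ≤ l₀ → K₀ ≤ K → ∑ τ ∈ Bad K t, B K t τ ≤ W K * ∑ τ ∈ T K, B K t τ) :
    RelWeightBound l₀ T A B (fun K t => if K₀ ≤ K then Bad K t else ∅)
      (Set.indicator {K | K₀ ≤ K} W) where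
  bad_subset K t ht := by
    by_cases hK : K₀ ≤ K
    · simp only [hK, if_true]; exact hsub K t ht hK
    · simp only [hK, if_false]; exact Finset.empty_subset _
  nonneg K := by
    by_cases hK : K₀ ≤ K
    · rw [Set.indicator_of_mem (show K ∈ {K | K₀ ≤ K} from hK)]; exact h0 K hK
    · rw [Set.indicator_of_notMem (show K ∉ {K | K₀ ≤ K} from hK)]
  lt_one K := by
    by_cases hK : K₀ ≤ K
    · rw [Set.indicator_of_mem (show K ∈ {K | K₀ ≤ K} from hK)]; exact h1 K hK
    · rw [Set.indicator_of_notMem (show K ∉ {K | K₀ ≤ K} from hK)]; exact one_pos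
  summable := hs.indicator _
  bad_left K t ht := by
    by_cases hK : K₀ ≤ K
    · simp only [hK, if_true]; rw [Set.indicator_of_mem (show K ∈ {K | K₀ ≤ K} from hK)]; exact hl K t ht hK
    · simp only [hK, if_false, Finset.sum_empty]
      rw [Set.indicator_of_notMem (show K ∉ {K | K₀ ≤ K} from hK), zero_mul]
  bad_right K t ht := by
    by_cases hK : K₀ ≤ K
    · simp only [hK, if_true]; rw [Set.indicator_of_mem (show K ∈ {K | K₀ ≤ K} from hK)]; exact hr K t ht hK
    · simp only [hK, if_false, Finset.sum_empty]
      rw [Set.indicator_of_notMem (show K ∉ {K | K₀ ≤ K} from hK), zero_mul]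

end Plug

/-! ## §2 The union bound by which a weight bound is assembled from local ones -/

section UnionBound

variable {α β : Type*} [DecidableEq β]

/-- Subadditivity of nonnegative sums over a (not necessarily disjoint) finite union. [folklore] -/
theorem sum_biUnion_le_sum (s : Finset α) (t : α → Finset β) {f : β → ℝ} (hf : ∀ b, 0 ≤ f b) :
    ∑ b ∈ s.biUnion t, f b ≤ ∑ a ∈ s, ∑ b ∈ t a, f b := by
  classical
  refine Finset.induction_on s (by simp) ?_
  intro a s ha ih
  rw [Finset.biUnion_insert, Finset.sum_insert ha]
  have hui := Finset.sum_union_inter (s₁ := t a) (s₂ := s.biUnion t) (f := f)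
  have hint : 0 ≤ ∑ b ∈ t a ∩ s.biUnion t, f b := Finset.sum_nonneg fun b _ => hf b
  linarith

/-- **UNION BOUND for relative weights**: if the bad class is covered by sub-classes `Bad x`, `x ∈ X` (e.g. indexed by
the POSITION and BIRTH SCALE of an old pending component), each of relative weight `≤ w x` with respect to the same
nonnegative family on `T`, then the bad class has relative weight `≤ Σ_x w x`. [folklore] -/
theorem relWeight_le_sum_of_cover (X : Finset α) (Badx : α → Finset β) {Bad T : Finset β} {a : β → ℝ}
    {w : α → ℝ} (ha : ∀ b, 0 ≤ a b) (hcov : Bad ⊆ X.biUnion Badx)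
    (hx : ∀ x ∈ X, ∑ b ∈ Badx x, a b ≤ w x * ∑ b ∈ T, a b) :
    ∑ b ∈ Bad, a b ≤ (∑ x ∈ X, w x) * ∑ b ∈ T, a b :=
  calc ∑ b ∈ Bad, a b ≤ ∑ b ∈ X.biUnion Badx, a b :=
        Finset.sum_le_sum_of_subset_of_nonneg hcov fun b _ _ => ha b
    _ ≤ ∑ x ∈ X, ∑ b ∈ Badx x, a b := sum_biUnion_le_sum X Badx ha
    _ ≤ ∑ x ∈ X, w x * ∑ b ∈ T, a b := Finset.sum_le_sum hx
    _ = (∑ x ∈ X, w x) * ∑ b ∈ T, a b := by rw [Finset.sum_mul]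

end UnionBound

/-! ## §3 The renewal arithmetic behind NE7b (counting and geometric sums; nothing of Bałaban's is asserted) -/

section Renewal

/-- **EVENT COUNT** (v1 said "renewal count").  If every step `x ∈ [j, K]` lies less than `N` steps after some element
of the finite set `S`, then `K + 1 − j ≤ N · #S`.  READING (the cell's, v1.1 per GAPS G-pv05g5-1 (b) / G-t4-U5c-2):
`S` = the EVENT steps of a pending large-field structure — its birth step `j`, its RENEWAL steps (new large field regions
created inside it) and its MERGER steps (joined with other components or new regions by the layer operations of a step,
[Balaban1989LargeFieldII] p. 386 second case — possibly with zero new regions; a merger restarts the window, p. 387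
«K ≤ K₂ + n₁ + R_{j+1}»); `N` = the maximal length of an EVENT-FREE epoch, after which ℝ has renormalised the structure
([Balaban1989LargeFieldI] p. 177 (i)/(ii); cell reading `N′ = R + n₁ + O(log_L d′)`, `t4/T4-XREAD-U5c.md` V5).  Hence a
pending structure born at step `j` and still pending at step `K` underwent at least `(K + 1 − j)/N − 1` events; v1's
"no renewal during N steps ⇒ renormalised" dropped the merger branch and is withdrawn.  The lemma itself is unchanged
finite combinatorics. [folklore] -/
theorem card_Icc_le_of_windows {j K N : ℕ} (S : Finset ℕ)
    (hcov : ∀ x ∈ Icc j K, ∃ s ∈ S, s ≤ x ∧ x < s + N) : K + 1 - j ≤ N * S.card := by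
  have hsub : Icc j K ⊆ S.biUnion (fun s => Ico s (s + N)) := by
    intro x hx
    rw [Finset.mem_biUnion]
    obtain ⟨s, hs, h1, h2⟩ := hcov x hx
    exact ⟨s, hs, Finset.mem_Ico.mpr ⟨h1, h2⟩⟩
  calc K + 1 - j = (Icc j K).card := (Nat.card_Icc j K).symm
    _ ≤ (S.biUnion fun s => Ico s (s + N)).card := Finset.card_le_card hsub
    _ ≤ ∑ s ∈ S, (Ico s (s + N)).card := Finset.card_biUnion_le
    _ = ∑ s ∈ S, N := Finset.sum_congr rfl fun s _ => by rw [Nat.card_Ico, add_tsub_cancel_left]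
    _ = N * S.card := by rw [Finset.sum_const, smul_eq_mul, mul_comm]

/-- PRODUCT OF EVENT COSTS: nonnegative factors each `≤ ρ` have product `≤ ρ^{#S}`; with `ρ ≤ 1` and `m₀ ≤ #S`
the product is `≤ ρ^{m₀}` (read, v1.1: each event costs at most `ρ = (entropy per event)·e^{−c·p₀}` — a renewal through
the new region's factor (1.79)/(1.85), a merger through the surplus `2(1 + β₀)^{−1}p₀(g_{j+1}) − O(1)3(100M)^dR^{d+2}_{j+1}`
that (1.88) discards and the cell's NE7b banks (`t4/T4-EST-U5c.md` §3 R1) — and at least `m₀` events happened). [folklore] -/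
theorem prod_le_pow_of_card_le {α : Type*} (S : Finset α) {f : α → ℝ} {ρ : ℝ} {m₀ : ℕ} (h0 : ∀ i ∈ S, 0 ≤ f i)
    (h1 : ∀ i ∈ S, f i ≤ ρ) (hρ0 : 0 ≤ ρ) (hρ1 : ρ ≤ 1) (hm : m₀ ≤ S.card) : ∏ i ∈ S, f i ≤ ρ ^ m₀ := by
  calc ∏ i ∈ S, f i ≤ ∏ _i ∈ S, ρ := Finset.prod_le_prod h0 h1
    _ = ρ ^ S.card := Finset.prod_const ρ
    _ ≤ ρ ^ m₀ := pow_le_pow_of_le_one hρ0 hρ1 hm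

/-- The NET SURVIVAL RATE per step of an old pending component (cell reading of NE7b's large-deviation count): the
bankable EVENT cost `p − E` per event-free window of `N` steps (`p` = the usable part of the large-field exponent `p₀(g)`
banked per event, renewal or merger (v1.1); `E` = the entropy of one event), spread per step, MINUS the positional
entropy `4·log L` per step of the component's birth position in the unit volume. [folklore] -/
noncomputable def survivalRate (p E N L : ℝ) : ℝ :=
  (p - E) / N - 4 * Real.log L

/-- **THE CONDITION OF NE7b** (T4-DAG v2 §2 U5c: "requires a condition of the shape `p₀(g)/N > 4 log L·(1 + o(1))`"):
the net survival rate is positive iff `p/N > 4·log L + E/N`. [folklore] -/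
theorem survivalRate_pos_iff {p E N L : ℝ} (_hN : 0 < N) :
    0 < survivalRate p E N L ↔ 4 * Real.log L + E / N < p / N := by
  unfold survivalRate
  rw [sub_div]
  constructor <;> intro h <;> linarith

/-- GEOMETRIC MAJORANT over the OLD birth scales: for `0 ≤ r < 1` and a finite set of ages all `≥ m`,
`Σ_{i ∈ s} r^i ≤ r^m/(1 − r)` (read: `r = e^{−survivalRate}`, ages `i = K − j > K − j⋆`). [folklore] -/
theorem sum_pow_le_of_le {r : ℝ} (h0 : 0 ≤ r) (h1 : r < 1) {s : Finset ℕ} {m : ℕ} (hm : ∀ i ∈ s, m ≤ i) :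
    ∑ i ∈ s, r ^ i ≤ r ^ m / (1 - r) := by
  have hinj : Set.InjOn (fun i => i - m) ↑s := by
    intro a ha b hb hab
    have h₁ := hm a ha
    have h₂ := hm b hb
    simp only at hab
    omega
  have hgeom := summable_geometric_of_lt_one h0 h1
  calc ∑ i ∈ s, r ^ i = ∑ i ∈ s, r ^ m * r ^ (i - m) := by
        refine Finset.sum_congr rfl fun i hi => ?_
        rw [← pow_add, Nat.add_sub_cancel' (hm i hi)]
    _ = r ^ m * ∑ n ∈ s.image (fun i => i - m), r ^ n := by rw [Finset.mul_sum, Finset.sum_image hinj]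
    _ ≤ r ^ m * ∑' n, r ^ n :=
        mul_le_mul_of_nonneg_left (hgeom.sum_le_tsum _ fun n _ => pow_nonneg h0 n) (pow_nonneg h0 m)
    _ = r ^ m / (1 - r) := by rw [tsum_geometric_of_lt_one h0 h1, div_eq_mul_inv]

/-- The age sum over the old birth scales `j < j⋆ ≤ K`: `Σ_{j < j⋆} r^{K − j} ≤ r^{K − j⋆ + 1}/(1 − r)`. [folklore] -/
theorem sum_range_pow_sub_le {r : ℝ} (h0 : 0 ≤ r) (h1 : r < 1) {jstar K : ℕ} (hj : jstar ≤ K) :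
    ∑ j ∈ range jstar, r ^ (K - j) ≤ r ^ (K - jstar + 1) / (1 - r) := by
  have hinj : Set.InjOn (fun j => K - j) ↑(range jstar) := by
    intro a ha b hb hab
    have h₁ := Finset.mem_range.mp ha
    have h₂ := Finset.mem_range.mp hb
    simp only at hab
    omega
  rw [← Finset.sum_image hinj (f := fun i => r ^ i)]
  refine sum_pow_le_of_le h0 h1 fun i hi => ?_
  obtain ⟨j, hj', rfl⟩ := Finset.mem_image.mp hi
  have := Finset.mem_range.mp hj'
  omega

/-- **SUMMABILITY OVER THE NUMBER OF STEPS** of the weight majorant `V · r^{K − j⋆(K)}` when the matching scale leaves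
a positive FRACTION of the steps old-vs-recent: `c·K ≤ K − j⋆(K)` for some `c > 0` (e.g. `j⋆(K) = ⌊K/2⌋`), `0 < r < 1`,
`0 ≤ V`.  (Then the majorant also tends to `0`, so it is `< 1/2` for `K ≥ K₀` — the early steps go to
`relWeightBound_of_eventually`.) [folklore] -/
theorem summable_weightMajorant {r V c : ℝ} (h0 : 0 < r) (h1 : r < 1) (hV : 0 ≤ V) (hc : 0 < c)
    {jstar : ℕ → ℕ} (hfrac : ∀ K : ℕ, c * K ≤ ((K - jstar K : ℕ) : ℝ)) :
    Summable (fun K => V * r ^ (K - jstar K)) := by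
  have hrc0 : 0 ≤ r ^ c := Real.rpow_nonneg h0.le c
  have hrc1 : r ^ c < 1 := Real.rpow_lt_one h0.le h1 hc
  -- `r^{K − j⋆ K} ≤ (r^c)^K` since `c·K ≤ K − j⋆ K` and `0 < r ≤ 1`
  have key : ∀ K : ℕ, r ^ (K - jstar K) ≤ (r ^ c) ^ K := by
    intro K
    rw [← Real.rpow_natCast r (K - jstar K), ← Real.rpow_natCast (r ^ c) K, ← Real.rpow_mul h0.le]
    exact Real.rpow_le_rpow_of_exponent_ge h0 h1.le (hfrac K)
  exact Summable.of_nonneg_of_le (fun K => mul_nonneg hV (pow_nonneg h0.le _))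
    (fun K => mul_le_mul_of_nonneg_left (key K) hV) ((summable_geometric_of_lt_one hrc0 hrc1).mul_left V)

/-- … and the majorant is eventually below any positive threshold (so `W K < 1`, indeed `≤ 1/2`, from some `K₀` on).
[folklore] -/
theorem eventually_weightMajorant_lt {r V c ε : ℝ} (h0 : 0 < r) (h1 : r < 1) (hV : 0 ≤ V) (hc : 0 < c) (hε : 0 < ε)
    {jstar : ℕ → ℕ} (hfrac : ∀ K : ℕ, c * K ≤ ((K - jstar K : ℕ) : ℝ)) :
    ∀ᶠ K in atTop, V * r ^ (K - jstar K) < ε :=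
  ((summable_weightMajorant h0 h1 hV hc hfrac).tendsto_atTop_zero).eventually (gt_mem_nhds hε)

/-- THE TWO-RATE FORM OF THE MAJORANT (cell reading of NE7b, T4-DAG v2 §2 U5c: "(renewal cost)^{(K−j⋆)/N} against
[v1.1: read "event (renewal-or-merger) cost"]
positional entropy L^{4(K−j⋆)}"): with `vol` unit cubes, birth-position entropy `Λ^{K − j}` at birth scale `j`
(`Λ = L⁴`) and survival cost `σ^{K − j}` per step of age (`σ = (E_ren·e^{−p})^{1/N}`), the sum over old birth scales is
the age sum of `r = Λ·σ`, and it is `≤ vol·r^{K − j⋆ + 1}/(1 − r)` as soon as `r < 1` — i.e. `survivalRate > 0`.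
[folklore] -/
theorem twoRate_majorant_le {vol Λ σ : ℝ} (hvol : 0 ≤ vol) (hΛ : 0 ≤ Λ) (hσ : 0 ≤ σ) (hr : Λ * σ < 1)
    {jstar K : ℕ} (hj : jstar ≤ K) :
    vol * ∑ j ∈ range jstar, Λ ^ (K - j) * σ ^ (K - j) ≤ vol * ((Λ * σ) ^ (K - jstar + 1) / (1 - Λ * σ)) := by
  refine mul_le_mul_of_nonneg_left ?_ hvol
  simp_rw [← mul_pow]
  exact sum_range_pow_sub_le (mul_nonneg hΛ hσ) hr hj

/-- `r = Λ·σ < 1` with `Λ = e^{4 log L·1}`-type entropy and `σ = e^{−(p − E)/N}` survival: `e^{4 log L}·e^{−(p−E)/N} < 1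
↔ survivalRate p E N L > 0`. [folklore] -/
theorem exp_entropy_mul_exp_survival_lt_one_iff {p E N L : ℝ} :
    Real.exp (4 * Real.log L) * Real.exp (-((p - E) / N)) < 1 ↔ 0 < survivalRate p E N L := by
  rw [← Real.exp_add, Real.exp_lt_one_iff, survivalRate]
  constructor <;> intro h <;> linarith

end Renewal

end Literature.MathematicalPhysics.QuantumFieldTheory.Balaban1983to89.T4WeightBudget
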